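import Summits.HodgeConjecture.HodgeConjecture.Theorems.Ring2WeilCoverageCMFieldAllPrimesT
import HarnessLib

/-!
# Weil-type components over quartic CM fields, IX (part U): from integral witnesses to CLASSES — `[π] = [1]` or
# `[3π] = [1]` for every prime of `ℤ[√2]` split in `E = ℚ(√-(3+√2))`, by the character at the tame place `(σ)`

research route conditional on HC_CM; not a corollary; Q11.4-sentence-2 already refuted in dim ≥ 3. Cell
`pub-hodge-ring2`, seat `ring2-b03` (gen 53); `HOME/WEIL-FAMILY-COVERAGE.md` §b03.5, seventh table
(`E = F(η)`, `η² = σ = -3-√2`, `F = ℚ(√2)`, `R = S² + 6S + 7`). Part T gives, for every split-type prime element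
`π = u + vσ` of `ℤ[σ]`, an integral `z ∈ ℤ[η]` and a totally positive `μ ∈ ℤ[σ]` with `Nm(z) = π·μ`, `N(μ) = 2^e`
(pure integer statements; the outer induction `splitType_witness` is §0 of this file, assembling part S's boxes,
part R's descent and part T's table). This file then moves them to Deligne's carriers (`Deligne1982/WeilTypeCMDiscriminant`:
`realField R = F`, `cmNormResidueGroup R = F^×/Nm_{E/F}(E^×)`):

* §1 the coordinate product in `F` and the DYADIC STRUCTURE: a totally positive `μ` with `N(μ) = 2^e` is
  `(-1-σ)^e·ω²` (`-1-σ = 2 + √2` generates the dyadic prime; the cofactor is a totally positive unit, a square by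
  Pell, part P), with `μ ≡ (-1)^e ω₀² (mod σ)`;
* §2 **`class_of_witness`**: `Nm(z) = π·μ` then reads `x² - σy² = π(-1-σ)^e ω²` in `F`, so `[π] = [-1-σ]^e`
  (`mk_eq_splitDiscriminantClassCM_two_of_normForm`), and `[-1-σ] = [3]` (`3(-1-σ) = Nm(-2-σ+η)`); the parity
  of `e` is read off mod `σ` (`𝔽₇`): `A² ≡ u·(-1)^e·ω₀²`, so **`[π] = [1]` if `u` is a square mod `7`, and
  `[3π] = [1]` if not** — the character of `F^×/Nm(E^×)` at the tame ramified place `(σ)` decides the class of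
  every split-type prime.

No named fact, no definition, no `sorry`; nothing about the Hodge conjecture is asserted.
References: [Deligne1982HodgeCycles] §4 p. 30 (1), Cor. 4.2; [Landherr1936HermitianForms]. -/

noncomputable section

set_option linter.dupNamespace false

open Polynomial

namespace Summit.HodgeConjecture.HodgeConjecture.Ring2.WeilCoverageCM

open Literature.AlgebraicGeometry.Deligne1982
open Literature.AlgebraicGeometry.HodgeTheory (splitDiscriminantClassCM)

/-! ### §0 `P⁺` for every split-type prime element (the outer induction) -/

/-- **Every split-type prime element of `ℤ[σ]` has an integral norm witness with a totally positive multiplier of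
2-power norm** (`P⁺`), for both kinds at once, by induction on a norm bound `n`: the totally positive degree-one
`θ = u + vσ` of prime norm `ℓ ≤ n`, `ℓ ≠ 2`, with `-t` a square mod `ℓ`; and the inert rational primes `q`
(`2` a non-square) with `q² ≤ n` and `7` a square mod `q`. Large norms by part S's box and part R's descent (the
hypotheses `HWdeg`/`HWinert` of `aux_descent` are the induction hypothesis), small norms by §2 and `q = 3`.
[cite: Deligne1982HodgeCycles, §4 p. 30 (1) and Cor. 4.2] [cite: Landherr1936HermitianForms] -/
theorem splitType_witness : ∀ n : ℕ,
    (∀ (u v g₀ g₁ t : ℤ) (ℓ : ℕ), ℓ.Prime → ℓ ≠ 2 → ℓ ≤ n →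
      u ^ 2 - 6 * u * v + 7 * v ^ 2 = ℓ → u * g₀ - 7 * v * g₁ = t → v * g₀ + u * g₁ - 6 * v * g₁ = 1 →
      0 < u - 3 * v → IsSquare (-(t : ZMod ℓ)) →
      ∃ a₀ a₁ b₀ b₁ m₀ m₁ : ℤ, ∃ e : ℕ,
        a₀ ^ 2 - 7 * a₁ ^ 2 + 14 * b₀ * b₁ - 42 * b₁ ^ 2 = u * m₀ - 7 * v * m₁ ∧
        2 * a₀ * a₁ - 6 * a₁ ^ 2 - b₀ ^ 2 + 12 * b₀ * b₁ - 29 * b₁ ^ 2 = u * m₁ + v * m₀ - 6 * v * m₁ ∧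
        0 < m₀ - 3 * m₁ ∧ m₀ ^ 2 - 6 * m₀ * m₁ + 7 * m₁ ^ 2 = 2 ^ e) ∧
    (∀ q : ℕ, q.Prime → q ≠ 2 → q ^ 2 ≤ n → ¬ IsSquare (2 : ZMod q) → IsSquare (7 : ZMod q) →
      ∃ a₀ a₁ b₀ b₁ m₀ m₁ : ℤ, ∃ e : ℕ,
        a₀ ^ 2 - 7 * a₁ ^ 2 + 14 * b₀ * b₁ - 42 * b₁ ^ 2 = (q : ℤ) * m₀ - 7 * 0 * m₁ ∧
        2 * a₀ * a₁ - 6 * a₁ ^ 2 - b₀ ^ 2 + 12 * b₀ * b₁ - 29 * b₁ ^ 2 = (q : ℤ) * m₁ + 0 * m₀ - 6 * 0 * m₁ ∧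
        0 < m₀ - 3 * m₁ ∧ m₀ ^ 2 - 6 * m₀ * m₁ + 7 * m₁ ^ 2 = 2 ^ e) := by
  intro n
  induction n with
  | zero =>
    refine ⟨fun u v g₀ g₁ t ℓ hℓ _ hle => absurd hle (not_le.2 hℓ.pos), fun q hq _ hle => ?_⟩
    exact absurd hle (not_le.2 (pow_pos hq.pos 2))
  | succ n ih =>
    obtain ⟨ih1, ih2⟩ := ih
    constructor
    · intro u v g₀ g₁ t ℓ hℓ hℓ2 hle hN ht hγ hpos hsq
      rcases Nat.lt_or_ge ℓ (n + 1) with hlt | hge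
      · exact ih1 u v g₀ g₁ t ℓ hℓ hℓ2 (Nat.lt_succ_iff.1 hlt) hN ht hγ hpos hsq
      have hℓn : ℓ = n + 1 := le_antisymm hle hge
      by_cases hsmall : ℓ < 182
      · exact base_degOne_witness u v g₀ g₁ t ℓ hℓ hℓ2 hsmall hN ht hγ hpos hsq
      rw [not_lt] at hsmall
      -- the box, then the descent with bound `ℓ`
      obtain ⟨A, B, C, D, M₀, M₁, hX, hY, hposμ, hNpos, hNlt⟩ := degOne_box hℓ hN ht hγ hpos hsq
      have hK : M₀ ^ 2 - 6 * M₀ * M₁ + 7 * M₁ ^ 2 = 2 ^ 0 * ((M₀ ^ 2 - 6 * M₀ * M₁ + 7 * M₁ ^ 2).toNat : ℕ) := by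
        rw [pow_zero, one_mul, Int.toNat_of_nonneg hNpos.le]
      have hKlt : (M₀ ^ 2 - 6 * M₀ * M₁ + 7 * M₁ ^ 2).toNat < ℓ := by
        have : ((M₀ ^ 2 - 6 * M₀ * M₁ + 7 * M₁ ^ 2).toNat : ℤ) < ℓ := by
          rw [Int.toNat_of_nonneg hNpos.le]; exact lt_of_lt_of_le hNlt (by exact_mod_cast hsmall)
        exact_mod_cast this
      -- no odd prime divides both `N(μ₀) < 182 ≤ ℓ` and `N(π) = ℓ`
      have hcop : ∀ q : ℕ, q.Prime → q ≠ 2 → (q : ℤ) ∣ M₀ ^ 2 - 6 * M₀ * M₁ + 7 * M₁ ^ 2 →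
          ¬ (q : ℤ) ∣ u ^ 2 - 6 * u * v + 7 * v ^ 2 := by
        intro q hq _ hqd hqℓ
        rw [hN] at hqℓ
        have hqℓ' : q ∣ ℓ := by exact_mod_cast hqℓ
        have hq1 := hq.one_lt
        rcases (Nat.dvd_prime hℓ).1 hqℓ' with h | h
        · omega
        · have hle' := Int.le_of_dvd hNpos hqd
          rw [h] at hle'
          have : (182 : ℤ) ≤ ℓ := by exact_mod_cast hsmall
          linarith
      obtain ⟨e', A', B', C', D', M₀', M₁', hX', hY', hpos', hN'⟩ := aux_descent u v ℓ
        (fun u' v' g₀' g₁' t' ℓ' hℓ' hℓ'2 hlt' hN' ht' hγ' hpos' hsq' =>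
          ih1 u' v' g₀' g₁' t' ℓ' hℓ' hℓ'2 (by omega) hN' ht' hγ' hpos' hsq')
        (fun q hq hq2 hlt' h2 h7 => ih2 q hq hq2 (by omega) h2 h7)
        _ hKlt 0 A B C D M₀ M₁ hK hposμ hcop hX hY
      exact ⟨A', B', C', D', M₀', M₁', e', hX', hY', hpos', hN'⟩
    · intro q hq hq2 hle h2 h7
      rcases Nat.lt_or_ge (q ^ 2) (n + 1) with hlt | hge
      · exact ih2 q hq hq2 (Nat.lt_succ_iff.1 hlt) h2 h7
      by_cases hq3 : q = 3
      · -- `3·(2 + √2) = Nm(1 + √2 + η)`: `w = (-2, -1, 1, 0)`, `μ = -1 - σ`, `N(μ) = 2`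
        subst hq3
        exact ⟨-2, -1, 1, 0, -1, -1, 1, by norm_num, by norm_num, by norm_num, by norm_num⟩
      -- `q ≥ 19` (the inert primes `5, 11, 13` are inert in `E/F`; `7, 17` split in `F`), so `q² > 181`
      have hq19 : 19 ≤ q := by
        by_contra hlt
        rw [not_le] at hlt
        interval_cases q
        all_goals first
          | (revert hq; decide)
          | exact hq2 rfl
          | exact hq3 rfl
          | (revert h7; decide)
          | (revert h2; decide)
      obtain ⟨A, B, C, D, M₀, M₁, hX, hY, hposμ, hNpos, hNlt⟩ := inert_box hq hq2 h2 h7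
      have hK : M₀ ^ 2 - 6 * M₀ * M₁ + 7 * M₁ ^ 2 = 2 ^ 0 * ((M₀ ^ 2 - 6 * M₀ * M₁ + 7 * M₁ ^ 2).toNat : ℕ) := by
        rw [pow_zero, one_mul, Int.toNat_of_nonneg hNpos.le]
      have hq2big : (182 : ℤ) ≤ (q : ℤ) ^ 2 := by
        have : (19 : ℤ) ≤ q := by exact_mod_cast hq19
        nlinarith
      have hKlt : (M₀ ^ 2 - 6 * M₀ * M₁ + 7 * M₁ ^ 2).toNat < q ^ 2 := by
        have : ((M₀ ^ 2 - 6 * M₀ * M₁ + 7 * M₁ ^ 2).toNat : ℤ) < (q : ℤ) ^ 2 := by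
          rw [Int.toNat_of_nonneg hNpos.le]; linarith
        exact_mod_cast this
      -- an odd prime dividing `N(μ₀) < 182` and `N(π) = q²` would be `q`, and then `q² ∣ N(μ₀)`
      have hcop : ∀ q' : ℕ, q'.Prime → q' ≠ 2 → (q' : ℤ) ∣ M₀ ^ 2 - 6 * M₀ * M₁ + 7 * M₁ ^ 2 →
          ¬ (q' : ℤ) ∣ (q : ℤ) ^ 2 - 6 * q * 0 + 7 * 0 ^ 2 := by
        intro q' hq' _ hqd hqπ
        have hq'p : Prime (q' : ℤ) := Nat.prime_iff_prime_int.1 hq'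
        have hqq : (q' : ℤ) ∣ (q : ℤ) ^ 2 := by
          have e1 : (q : ℤ) ^ 2 - 6 * q * 0 + 7 * 0 ^ 2 = (q : ℤ) ^ 2 := by ring
          rwa [e1] at hqπ
        have hqq' : q' ∣ q := by exact_mod_cast hq'p.dvd_of_dvd_pow hqq
        have hq'1 := hq'.one_lt
        rcases (Nat.dvd_prime hq).1 hqq' with h | h
        · omega
        subst h
        obtain ⟨⟨c, hc⟩, ⟨d, hd⟩⟩ := zs_inert_dvd hq h2 hqd
        have hNlt' := hNlt
        have hNpos' := hNpos
        rw [hc, hd] at hNlt' hNpos'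
        have e2 : ((q' : ℤ) * c) ^ 2 - 6 * ((q' : ℤ) * c) * ((q' : ℤ) * d) + 7 * ((q' : ℤ) * d) ^ 2
            = (q' : ℤ) ^ 2 * (c ^ 2 - 6 * c * d + 7 * d ^ 2) := by ring
        rw [e2] at hNlt' hNpos'
        have hcd : 0 < c ^ 2 - 6 * c * d + 7 * d ^ 2 := pos_of_mul_pos_right hNpos' (by positivity)
        nlinarith
      obtain ⟨e', A', B', C', D', M₀', M₁', hX', hY', hpos', hN'⟩ := aux_descent (q : ℤ) 0 (q ^ 2)
        (fun u' v' g₀' g₁' t' ℓ' hℓ' hℓ'2 hlt' hN' ht' hγ' hpos' hsq' =>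
          ih1 u' v' g₀' g₁' t' ℓ' hℓ' hℓ'2 (by omega) hN' ht' hγ' hpos' hsq')
        (fun q' hq' hq'2 hlt' h2' h7' => ih2 q' hq' hq'2 (by omega) h2' h7')
        _ hKlt 0 A B C D M₀ M₁ hK hposμ hcop hX hY
      exact ⟨A', B', C', D', M₀', M₁', e', hX', hY', hpos', hN'⟩


section Carrier

variable {R : Polynomial ℤ} (hR : R = X ^ 2 + C 6 * X + C 7) [Fact (Irreducible (realPolyQ R))]
include hR

/-! ### §1 Coordinates in `F` and the dyadic structure -/

/-- `σ² + 6σ + 7 = 0` in `F`, numerals. [cite: Deligne1982HodgeCycles, §4 p. 30] -/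
theorem root_rel_six_seven :
    AdjoinRoot.root (realPolyQ R) ^ 2 + 6 * AdjoinRoot.root (realPolyQ R) + 7 = 0 := by
  have h := root_rel_quadratic hR
  push_cast at h
  exact h

/-- **The product of `ℤ[σ]` in coordinates, inside `F`**: `(a + bσ)(c + dσ) = (ac - 7bd) + (ad + bc - 6bd)σ`.
[cite: Deligne1982HodgeCycles, §4 p. 30] -/
theorem of_pair_mul (a b c d : ℚ) :
    (AdjoinRoot.of (realPolyQ R) a + AdjoinRoot.of (realPolyQ R) b * AdjoinRoot.root (realPolyQ R)) *
      (AdjoinRoot.of (realPolyQ R) c + AdjoinRoot.of (realPolyQ R) d * AdjoinRoot.root (realPolyQ R))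
    = AdjoinRoot.of (realPolyQ R) (a * c - 7 * b * d) +
      AdjoinRoot.of (realPolyQ R) (a * d + b * c - 6 * b * d) * AdjoinRoot.root (realPolyQ R) := by
  have hσ := root_rel_six_seven hR
  simp only [map_sub, map_add, map_mul, map_ofNat]
  linear_combination (AdjoinRoot.of (realPolyQ R) b * AdjoinRoot.of (realPolyQ R) d) * hσ

omit hR in
/-- `-1 - σ` in coordinates. [cite: Deligne1982HodgeCycles, §4 p. 30] -/
theorem of_negOne_negOne :
    AdjoinRoot.of (realPolyQ R) ((-1 : ℤ) : ℚ) + AdjoinRoot.of (realPolyQ R) ((-1 : ℤ) : ℚ) * AdjoinRoot.root (realPolyQ R)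
      = -1 - AdjoinRoot.root (realPolyQ R) := by
  simp only [Int.cast_neg, Int.cast_one, map_neg, map_one]
  ring

/-- An element of `ℤ[σ]` with nonzero norm is nonzero in `F`. [cite: Deligne1982HodgeCycles, §4 p. 30] -/
theorem of_pair_ne_zero {a b : ℤ} (hN : a ^ 2 - 6 * a * b + 7 * b ^ 2 ≠ 0) :
    AdjoinRoot.of (realPolyQ R) (a : ℚ) + AdjoinRoot.of (realPolyQ R) (b : ℚ) * AdjoinRoot.root (realPolyQ R) ≠ 0 := by
  intro h
  obtain ⟨ha, hb⟩ := coords_eq_zero_quadratic hR h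
  have ha' : a = 0 := by exact_mod_cast ha
  have hb' : b = 0 := by exact_mod_cast hb
  rw [ha', hb'] at hN
  exact hN (by ring)

/-- **Dyadic structure.** A totally positive `μ = M₀ + M₁σ` with `N(μ) = 2^e` is `(-1-σ)^e·ω²` in `F` for a unit
`ω = w₀ + w₁σ` of `ℤ[σ]`, and `M₀ ≡ (-1)^e w₀² (mod 7)` (induction on `e`: `2 ∣ N(μ)` gives `(3+σ) ∣ μ`, i.e.
`μ = (-1-σ)μ'` with `μ'` totally positive of norm `2^{e-1}`; at `e = 0` Pell). [folklore] -/
theorem dyadic_structure : ∀ (e : ℕ) (M₀ M₁ : ℤ), 0 < M₀ - 3 * M₁ → M₀ ^ 2 - 6 * M₀ * M₁ + 7 * M₁ ^ 2 = 2 ^ e →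
    ∃ w₀ w₁ : ℤ, (w₀ ^ 2 - 6 * w₀ * w₁ + 7 * w₁ ^ 2) ^ 2 = 1 ∧
      AdjoinRoot.of (realPolyQ R) (M₀ : ℚ) + AdjoinRoot.of (realPolyQ R) (M₁ : ℚ) * AdjoinRoot.root (realPolyQ R)
        = (-1 - AdjoinRoot.root (realPolyQ R)) ^ e *
          (AdjoinRoot.of (realPolyQ R) (w₀ : ℚ) + AdjoinRoot.of (realPolyQ R) (w₁ : ℚ) * AdjoinRoot.root (realPolyQ R)) ^ 2 ∧
      (M₀ : ZMod 7) = (-1) ^ e * (w₀ : ZMod 7) ^ 2 := by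
  intro e
  induction e with
  | zero =>
    intro M₀ M₁ hpos hN
    rw [pow_zero] at hN
    obtain ⟨w₀, w₁, h0, h1, hNw⟩ := totPos_unit_sq hpos hN
    refine ⟨w₀, w₁, hNw, ?_, ?_⟩
    · rw [pow_zero, one_mul, sq, of_pair_mul hR, h0, h1]
      push_cast
      simp only [map_sub, map_mul, map_add, map_ofNat, map_pow]
      ring
    · rw [h0, pow_zero, one_mul]
      have h7 : (7 : ZMod 7) = 0 := by decide
      push_cast
      linear_combination (-(w₁ : ZMod 7) ^ 2) * h7
  | succ e ih =>
    intro M₀ M₁ hpos hN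
    -- `2 ∣ N(μ)`, so `μ = (-1-σ)·(x, y)`
    have h2 : (2 : ℤ) ∣ M₀ + M₁ := by
      rw [← zs_two_dvd_norm_iff, hN, pow_succ]
      exact Dvd.intro_left _ rfl
    obtain ⟨k, hk⟩ := h2
    obtain ⟨x, hx⟩ : ∃ x : ℤ, x = 5 * k - 6 * M₁ := ⟨_, rfl⟩
    obtain ⟨y, hy⟩ : ∃ y : ℤ, y = k - M₁ := ⟨_, rfl⟩
    have hM₀ : M₀ = (-1) * x - 7 * (-1) * y := by rw [hx, hy]; linear_combination hk
    have hM₁ : M₁ = (-1) * y + (-1) * x - 6 * (-1) * y := by rw [hx, hy]; ring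
    rw [hM₀, hM₁] at hpos hN
    have hsp := totPos_specials.2.1
    have hpos' := totPos_cancel hsp.1 hsp.2 hpos (by rw [hN]; positivity)
    have hN' : x ^ 2 - 6 * x * y + 7 * y ^ 2 = 2 ^ e := by
      have h1 : (2 : ℤ) * (x ^ 2 - 6 * x * y + 7 * y ^ 2) = 2 * 2 ^ e := by
        rw [← pow_succ', ← hN, zs_norm_mul]; norm_num
      exact mul_left_cancel₀ two_ne_zero h1
    obtain ⟨w₀, w₁, hNw, hF, h7⟩ := ih x y hpos'.1 hN'
    refine ⟨w₀, w₁, hNw, ?_, ?_⟩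
    · rw [hM₀, hM₁]
      have e1 := of_pair_mul hR ((-1 : ℤ) : ℚ) ((-1 : ℤ) : ℚ) (x : ℚ) (y : ℚ)
      rw [of_negOne_negOne, hF] at e1
      push_cast at e1 ⊢
      simp only [map_sub, map_mul, map_add, map_neg, map_one, map_ofNat] at e1 ⊢
      rw [pow_succ]
      linear_combination -e1
    · rw [hM₀]
      push_cast
      rw [h7, pow_succ]
      have h70 : (7 : ZMod 7) = 0 := by decide
      linear_combination (y : ZMod 7) * h70

/-! ### §2 Classes from integral witnesses -/

/-- **`[3(-1-σ)] = [1]`**: `3(2 + √2) = Nm(1 + √2 + η)`, i.e. `(-2-σ)² - σ·1² = 3(-1-σ)`.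
[cite: Deligne1982HodgeCycles, §4 p. 30 (1) and Cor. 4.2] -/
theorem three_mul_negOne_sub_root_normForm :
    (-2 - AdjoinRoot.root (realPolyQ R)) ^ 2 - AdjoinRoot.root (realPolyQ R) * 1 ^ 2
      = 3 * (-1 - AdjoinRoot.root (realPolyQ R)) := by
  linear_combination root_rel_six_seven hR

/-- **Classes of split-type primes from integral witnesses.** `π = u + vσ` with `7 ∤ u` (prime to `(σ)`) and
an integral witness `Nm(z) = π·μ`, `μ` totally positive with `N(μ) = 2^e` (part T). Then, in
`F^×/Nm_{E/F}(E^×)`: if `u` is a square mod `7`, `[π] = [1]`; if not, `[3π] = [1]` (for any unit of `F` equal to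
`π`, resp. `3π`). Proof: `x² - σy² = π(-1-σ)^e ω²` in `F` (dyadic structure), `e` even gives `[π] = [1]`
directly and `e` odd gives `[3π] = [1]` after composing with `3(-1-σ) = Nm(-2-σ+η)`; reducing the witness mod `σ`
(`X ≡ A²`, `X = uM₀ - 7vM₁`, `M₀ ≡ (-1)^e ω₀²`) shows `u·(-1)^e` is a square mod `7`, which fixes the parity of
`e` (`-1` is a non-square mod `7`). [cite: Deligne1982HodgeCycles, §4 p. 30 (1) and Cor. 4.2]
[cite: Landherr1936HermitianForms] -/
theorem class_of_witness (u v : ℤ) (h7u : ¬ (7 : ℤ) ∣ u) (A B C D M₀ M₁ : ℤ) (e : ℕ)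
    (hX : A ^ 2 - 7 * B ^ 2 + 14 * C * D - 42 * D ^ 2 = u * M₀ - 7 * v * M₁)
    (hY : 2 * A * B - 6 * B ^ 2 - C ^ 2 + 12 * C * D - 29 * D ^ 2 = u * M₁ + v * M₀ - 6 * v * M₁)
    (hpos : 0 < M₀ - 3 * M₁) (hN : M₀ ^ 2 - 6 * M₀ * M₁ + 7 * M₁ ^ 2 = 2 ^ e) :
    (IsSquare ((u : ZMod 7)) → ∀ w : (realField R)ˣ,
        (w : realField R) = AdjoinRoot.of (realPolyQ R) (u : ℚ) + AdjoinRoot.of (realPolyQ R) (v : ℚ) * AdjoinRoot.root (realPolyQ R) →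
        (QuotientGroup.mk w : cmNormResidueGroup R) = splitDiscriminantClassCM R 2) ∧
    (¬ IsSquare ((u : ZMod 7)) → ∀ w : (realField R)ˣ,
        (w : realField R) = 3 * (AdjoinRoot.of (realPolyQ R) (u : ℚ) + AdjoinRoot.of (realPolyQ R) (v : ℚ) * AdjoinRoot.root (realPolyQ R)) →
        (QuotientGroup.mk w : cmNormResidueGroup R) = splitDiscriminantClassCM R 2) := by
  -- decidable facts mod `7` first (no local `Fact` instance yet)
  have hm1 : ¬ IsSquare (-1 : ZMod 7) := by decide
  have h70 : (7 : ZMod 7) = 0 := by decide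
  haveI : Fact (Irreducible (cmPolyQ R)) := fact_irreducible_cmPolyQ_of_pos hR (by norm_num) (by norm_num) disc_not_sq_six_seven
  haveI : Fact (Nat.Prime 7) := ⟨by norm_num⟩
  obtain ⟨w₀, w₁, hNw, hF, hM7⟩ := dyadic_structure hR e M₀ M₁ hpos hN
  -- the norm equation in `F`
  set ι := AdjoinRoot.of (realPolyQ R) with hι
  set σ := AdjoinRoot.root (realPolyQ R) with hσdef
  have hσ := root_rel_six_seven hR
  have hXF : (ι A) ^ 2 - 7 * (ι B) ^ 2 + 14 * ι C * ι D - 42 * (ι D) ^ 2 = ι u * ι M₀ - 7 * ι v * ι M₁ := by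
    have h := congrArg (fun z : ℤ => ι (z : ℚ)) hX
    push_cast at h
    simpa only [map_sub, map_mul, map_add, map_ofNat, map_pow] using h
  have hYF : 2 * ι A * ι B - 6 * (ι B) ^ 2 - (ι C) ^ 2 + 12 * ι C * ι D - 29 * (ι D) ^ 2
      = ι u * ι M₁ + ι v * ι M₀ - 6 * ι v * ι M₁ := by
    have h := congrArg (fun z : ℤ => ι (z : ℚ)) hY
    push_cast at h
    simpa only [map_sub, map_mul, map_add, map_ofNat, map_pow] using h
  have hnorm : (ι A + ι B * σ) ^ 2 - σ * (ι C + ι D * σ) ^ 2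
      = (ι u + ι v * σ) * (-1 - σ) ^ e * (ι w₀ + ι w₁ * σ) ^ 2 := by
    have h1 : (ι A + ι B * σ) ^ 2 - σ * (ι C + ι D * σ) ^ 2 = (ι u + ι v * σ) * (ι M₀ + ι M₁ * σ) := by
      rw [hσdef]
      linear_combination hXF + AdjoinRoot.root (realPolyQ R) * hYF
        + ((ι B) ^ 2 - 2 * ι C * ι D - (ι D) ^ 2 * (AdjoinRoot.root (realPolyQ R) - 6) - ι v * ι M₁) * hσ
    rw [h1, hι, hσdef, hF]
    ring
  have hω0 : ι (w₀ : ℚ) + ι (w₁ : ℚ) * σ ≠ 0 := by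
    refine of_pair_ne_zero hR ?_
    intro h; rw [h] at hNw; norm_num at hNw
  have hτ0 : (-1 - σ : realField R) ≠ 0 := by
    rw [hσdef, ← of_negOne_negOne]
    exact of_pair_ne_zero hR (by norm_num)
  -- the parity of `e` from the residue at `(σ)`: `A² = u·(-1)^e·w₀²` in `𝔽₇`
  have hXmod : ((A ^ 2 - 7 * B ^ 2 + 14 * C * D - 42 * D ^ 2 : ℤ) : ZMod 7) = ((u * M₀ - 7 * v * M₁ : ℤ) : ZMod 7) := by
    rw [hX]
  push_cast at hXmod
  have key7 : ((A : ZMod 7)) ^ 2 = (u : ZMod 7) * (-1) ^ e * (w₀ : ZMod 7) ^ 2 := by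
    linear_combination hXmod + (u : ZMod 7) * hM7 + ((B : ZMod 7) ^ 2 - 2 * C * D + 6 * D ^ 2 - v * M₁) * h70
  have hu0 : (u : ZMod 7) ≠ 0 := by
    rwa [Ne, ZMod.intCast_zmod_eq_zero_iff_dvd]
  have hw0 : (w₀ : ZMod 7) ≠ 0 := by
    intro h
    have hNw7 : (((w₀ ^ 2 - 6 * w₀ * w₁ + 7 * w₁ ^ 2) ^ 2 : ℤ) : ZMod 7) = ((1 : ℤ) : ZMod 7) := by rw [hNw]
    push_cast at hNw7
    rw [h] at hNw7
    have : ((7 : ZMod 7) * (w₁ : ZMod 7) ^ 2) ^ 2 = 1 := by linear_combination hNw7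
    rw [h70] at this
    norm_num at this
  -- `e` even ⟺ `u` a square mod 7
  have hpar : IsSquare ((u : ZMod 7)) ↔ Even e := by
    constructor
    · rintro ⟨r, hr⟩
      by_contra hodd
      rw [Nat.not_even_iff_odd] at hodd
      rw [hodd.neg_one_pow, hr] at key7
      have hr0 : r ≠ 0 := by rintro rfl; exact hu0 (by rw [hr]; ring)
      exact hm1 ⟨(A : ZMod 7) / (r * w₀), by field_simp; linear_combination -key7⟩
    · rintro ⟨k, hk⟩
      rw [hk, ← two_mul, pow_mul, neg_one_sq, one_pow, mul_one] at key7
      exact ⟨(A : ZMod 7) / w₀, by field_simp; linear_combination -key7⟩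
  constructor
  · intro hsq w hw
    obtain ⟨k, hk⟩ := hpar.1 hsq
    refine mk_eq_splitDiscriminantClassCM_two_of_normForm w (ι A + ι B * σ) (ι C + ι D * σ)
      ((-1 - σ) ^ k * (ι w₀ + ι w₁ * σ)) (mul_ne_zero (pow_ne_zero _ hτ0) hω0) ?_
    rw [hnorm, hw, hk]
    ring
  · intro hns w hw
    have hodd : Odd e := by
      rcases Nat.even_or_odd e with h | h
      · exact absurd h (fun h' => hns (hpar.2 h'))
      · exact h
    obtain ⟨k, hk⟩ := hodd
    -- compose with `3(-1-σ) = (-2-σ)² - σ·1²` (Brahmagupta): a norm equal to `3π·((-1-σ)^(k+1) ω)²`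
    have h3 := three_mul_negOne_sub_root_normForm hR
    refine mk_eq_splitDiscriminantClassCM_two_of_normForm w
      ((ι A + ι B * σ) * (-2 - σ) + σ * (ι C + ι D * σ) * 1)
      ((ι A + ι B * σ) * 1 + (ι C + ι D * σ) * (-2 - σ))
      ((-1 - σ) ^ (k + 1) * (ι w₀ + ι w₁ * σ)) (mul_ne_zero (pow_ne_zero _ hτ0) hω0) ?_
    have hb : ((ι A + ι B * σ) * (-2 - σ) + σ * (ι C + ι D * σ) * 1) ^ 2
        - σ * ((ι A + ι B * σ) * 1 + (ι C + ι D * σ) * (-2 - σ)) ^ 2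
        = ((ι A + ι B * σ) ^ 2 - σ * (ι C + ι D * σ) ^ 2) * ((-2 - σ) ^ 2 - σ * 1 ^ 2) := by ring
    rw [hb, hnorm, hσdef, h3, hw, hk]
    ring

end Carrier

end Summit.HodgeConjecture.HodgeConjecture.Ring2.WeilCoverageCM

end
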